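import Mathlib
import HarnessLib

/-!
# FLOOR-TRANSFER (CASE-DAG row G1.14, size S): a Rayleigh-quotient floor survives an approximate ground state

pub-rhpf cell (M2 seat, generation 3) — bookkeeping lemma requested by the lead (CLAIMS.md §C, "GAL-0/GAL-1/FLOOR-TRANSFER
if cheap").  HONEST FRAMING: long-odds MECHANISM SEARCH; no RH claims.  PROVED (kernel-checked, elementary, RH-free;
pure Hilbert-space algebra, nothing arithmetic):

for a bounded linear operator `Q` on a real inner-product space, unit vectors `u, g` with `‖u − g‖ ≤ d`:
  `⟪Q g, g⟫ − 2‖Q‖·d ≤ ⟪Q u, u⟫`.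
Reading (CASE-DAG G1.14 / FLOOR-TRANSFER): if `u = u_a` is the unit ground state of the window form `Q = Q_a` (so
`⟪Q u, u⟫ = ε₁(a)`) and `g = ĝ_a` is a unit guess with `dist(u_a, ĝ_a) ≤ d(a)`, then `ε₁(a) ≥ R(ĝ_a) − 2‖Q_a‖ d(a)`; with
`d(a)‖Q_a‖ → 0` and `R(ĝ_a) ≥ −r(a) → 0` this is an eventual FLOOR on `ε₁`, which the tree turns into RH
(`riemannHypothesis_of_evenGroundEnergy_floor`, `m2_inputs_floor_is_RH` — CLOSED-CLASSES M2-C1): an overlap-WITH-RATE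
hypothesis is RH-strength (a thermometer), exactly as the DAG labels it.  Instantiate with `E := EuclideanSpace ℝ (Fin n)`,
`Q := Matrix.toEuclideanCLM A` for Galerkin window matrices.  Nothing here implies or assumes RH.
-/

noncomputable section

set_option linter.dupNamespace false  -- the mandated namespace repeats `RiemannHypothesis`

open RealInnerProductSpace

namespace Summit.RiemannHypothesis.RiemannHypothesis.Theorems.PfPersistenceM2Leak

section FloorTransfer

variable {E : Type*} [NormedAddCommGroup E] [InnerProductSpace ℝ E]

/-- **Rayleigh numerators are `‖Q‖`-Lipschitz on bounded sets**:
`⟪Q g, g⟫ − ⟪Q u, u⟫ ≤ ‖Q‖ · ‖g − u‖ · (‖g‖ + ‖u‖)`. -/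
theorem inner_clm_sub_le (Q : E →L[ℝ] E) (u g : E) :
    ⟪Q g, g⟫ - ⟪Q u, u⟫ ≤ ‖Q‖ * ‖g - u‖ * (‖g‖ + ‖u‖) := by
  have hsplit : ⟪Q g, g⟫ - ⟪Q u, u⟫ = ⟪Q (g - u), g⟫ + ⟪Q u, g - u⟫ := by
    rw [map_sub, inner_sub_left, inner_sub_right]; ring
  have h1 : ⟪Q (g - u), g⟫ ≤ ‖Q‖ * ‖g - u‖ * ‖g‖ :=
    (real_inner_le_norm _ _).trans (mul_le_mul_of_nonneg_right (Q.le_opNorm _) (norm_nonneg _))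
  have h2 : ⟪Q u, g - u⟫ ≤ ‖Q‖ * ‖g - u‖ * ‖u‖ := by
    have := real_inner_le_norm (Q u) (g - u)
    calc ⟪Q u, g - u⟫ ≤ ‖Q u‖ * ‖g - u‖ := this
      _ ≤ ‖Q‖ * ‖u‖ * ‖g - u‖ := mul_le_mul_of_nonneg_right (Q.le_opNorm _) (norm_nonneg _)
      _ = ‖Q‖ * ‖g - u‖ * ‖u‖ := by ring
  rw [hsplit]
  nlinarith [h1, h2]

/-- **FLOOR-TRANSFER** (CASE-DAG G1.14, size S): for unit vectors `u, g` with `‖u − g‖ ≤ d`,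
`⟪Q g, g⟫ − 2‖Q‖ d ≤ ⟪Q u, u⟫`.  With `u` the unit ground state (`⟪Q u, u⟫ = ε₁`) this reads
`ε₁ ≥ R(g) − 2‖Q‖·dist(u, g)`. -/
theorem floor_transfer (Q : E →L[ℝ] E) {u g : E} (hu : ‖u‖ = 1) (hg : ‖g‖ = 1) {d : ℝ}
    (hd : ‖u - g‖ ≤ d) : ⟪Q g, g⟫ - 2 * ‖Q‖ * d ≤ ⟪Q u, u⟫ := by
  have h := inner_clm_sub_le Q u g
  rw [hu, hg, norm_sub_rev] at h
  have hQ : 0 ≤ ‖Q‖ := norm_nonneg _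
  nlinarith [mul_le_mul_of_nonneg_left hd hQ]

/-- **Floor from an approximate ground state, family form.**  Along any index set: if `u a` are unit ground states
(`⟪Q a (u a), u a⟫ = ε a`), `g a` unit guesses with `‖u a − g a‖ ≤ d a` and Rayleigh values `⟪Q a (g a), g a⟫ ≥ −r a`,
then `ε a ≥ −(r a + 2‖Q a‖ d a)` for every `a` — an explicit floor, vanishing whenever `r a → 0` and
`‖Q a‖ d a → 0` (the RH-strength input of CLOSED-CLASSES M2-C1). -/
theorem floor_of_approximate_groundState {ι : Type*} (Q : ι → (E →L[ℝ] E)) (u g : ι → E)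
    (ε r d : ι → ℝ) (hu : ∀ a, ‖u a‖ = 1) (hg : ∀ a, ‖g a‖ = 1) (hε : ∀ a, ⟪Q a (u a), u a⟫ = ε a)
    (hd : ∀ a, ‖u a - g a‖ ≤ d a) (hr : ∀ a, -r a ≤ ⟪Q a (g a), g a⟫) :
    ∀ a, -(r a + 2 * ‖Q a‖ * d a) ≤ ε a := by
  intro a
  have h := floor_transfer (Q a) (hu a) (hg a) (hd a)
  rw [hε a] at h
  linarith [hr a]

end FloorTransfer

end Summit.RiemannHypothesis.RiemannHypothesis.Theorems.PfPersistenceM2Leak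

end
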